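import Summits.Ventures.PercRepro.Night2LocalLossFairCount

/-!
# PercRepro — the top levels of a flat carry no covering preimage (night-2, gen 18)

A covering preimage `B = S ∖ y` of a set `S ⊆ G` is a bottom set, so `E ∖ B = (E ∖ G) ∪ (G ∖ S) ∪ {y}` has rank
`q + 2`; hence `|E ∖ G| + |G ∖ S| + 1 ≥ q + 2`.  So at a flat with `|E ∖ G| = d` every spanning `S` with
`|G ∖ S| ≤ q − d` has NO covering preimage (`coverPreimages_eq_empty_of_card_le`): `k1 S = 0`, `L1 S = 0`,
`capS S = 1` and `cap2 S = 1` (**`cap2_eq_one_of_card_le`**).  In the fair-share loss routing this is the residual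
capacity of the top `q − d + 1` levels of targets, the ones the census of `proofs/NIGHT-2-g18.md` §9 shows at
`cap2 = 1` in every cell.
-/

namespace PercRepro.Shadow

open Finset PerFlat ThmH

variable {α : Type*} [DecidableEq α] {M : Matroid α} [M.Finite]

open scoped Classical in
/-- A set `S` with `|E ∖ G| + |G ∖ S| + 1 ≤ q + 1` has no covering preimage. -/
theorem coverPreimages_eq_empty_of_card_le {q : ℕ} {G : Finset α} (hG : G ∈ flatsQ M (q + 1)) {S : Finset α}
    (hcard : (gr M \ G).card + (G \ S).card + 1 ≤ q + 1) :
    coverPreimages M (Uq M (q + 2) q) G S = ∅ := by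
  have hGg : G ⊆ gr M := (mem_flatsQ.1 hG).1
  rw [Finset.eq_empty_iff_forall_notMem]
  intro B hB
  rw [mem_coverPreimages] at hB
  obtain ⟨hBm, hcov⟩ := hB
  obtain ⟨y, hy, hyS⟩ := mem_coverSets.1 hcov
  have hBU : B ∈ Uq M (q + 2) q := (mem_membersIn.1 hBm).1
  have hsub : gr M \ B ⊆ (gr M \ G) ∪ (G \ S) ∪ {y} := by
    intro x hx
    rw [Finset.mem_sdiff] at hx
    rw [Finset.mem_union, Finset.mem_union, Finset.mem_sdiff, Finset.mem_sdiff, Finset.mem_singleton]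
    by_cases hxG : x ∈ G
    · by_cases hxS : x ∈ S
      · right
        have : x ∈ insert y B := by rw [hyS]; exact hxS
        rw [Finset.mem_insert] at this
        exact this.resolve_right hx.2
      · exact Or.inl (Or.inr ⟨hxG, hxS⟩)
    · exact Or.inl (Or.inl ⟨hx.1, hxG⟩)
  have hcard' : (gr M \ B).card ≤ q + 1 := by
    calc (gr M \ B).card ≤ ((gr M \ G) ∪ (G \ S) ∪ {y}).card := Finset.card_le_card hsub
      _ ≤ ((gr M \ G) ∪ (G \ S)).card + ({y} : Finset α).card := Finset.card_union_le _ _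
      _ ≤ (gr M \ G).card + (G \ S).card + 1 := by
          rw [Finset.card_singleton]; exact Nat.add_le_add_right (Finset.card_union_le _ _) 1
      _ ≤ q + 1 := hcard
  have hr : M.eRk ((gr M \ B : Finset α) : Set α) = ((q + 2 : ℕ) : ℕ∞) := (mem_Uq.1 hBU).2.2
  have hle : M.eRk ((gr M \ B : Finset α) : Set α) ≤ ((gr M \ B).card : ℕ∞) := by
    calc M.eRk ((gr M \ B : Finset α) : Set α) ≤ ((gr M \ B : Finset α) : Set α).encard := M.eRk_le_encard _
      _ = ((gr M \ B).card : ℕ∞) := by rw [Set.encard_coe_eq_coe_finsetCard]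
  rw [hr] at hle
  have : q + 2 ≤ (gr M \ B).card := by exact_mod_cast hle
  omega

open scoped Classical in
/-- At the top levels (`|E ∖ G| + |G ∖ S| ≤ q`) the residual capacity is `1`. -/
theorem cap2_eq_one_of_card_le {q : ℕ} {G : Finset α} (hG : G ∈ flatsQ M (q + 1)) {S : Finset α}
    (hcard : (gr M \ G).card + (G \ S).card + 1 ≤ q + 1) : cap2 M q G S = 1 := by
  have he := coverPreimages_eq_empty_of_card_le hG hcard
  have hk : k1 M q G S = 0 := by
    unfold k1; rw [he, Finset.filter_empty, Finset.card_empty]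
  have hL : L1 M q G S = 0 := by
    unfold L1; rw [he, Finset.filter_empty, Finset.sum_empty]
  unfold cap2 capS
  rw [hk, hL]
  simp

end PercRepro.Shadow
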